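import Summits.QuantumFields.YangMills.Theorems.PoincareLipschitzSobolevCubeExtraction
import Summits.QuantumFields.YangMills.Theorems.PoincareLipschitzCompetitorTransfer
import Summits.QuantumFields.YangMills.Theorems.PoincareLipschitzShellPigeonhole
import Summits.QuantumFields.YangMills.Theorems.PoincareLipschitzMinimisingMapCompactnessLetters
import HarnessLib

/-!
# Crux `BlockLipschitzL` (stmt-QuantumFields-23533) ∕ `HistoryTailL` (stmt-QuantumFields-19936), LINE 25 «CompactnessTransfer»,
# (C)-PROOF brick (C-e1) «ENERGY CONVERGENCE ON EVERY BALL — NO CONCENTRATION FOR MINIMISING SEQUENCES INTO `S³`»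

Cell `ym3-torus` (YM ladder rung R3 = continuum SU(2) Yang–Mills on T³ — a RUNG, NOT the Clay problem: not d = 4, not
infinite volume, not a mass gap); WIDTH helper seat `ym-ust-19936-w2` g13, (C)-PROOF lineage project (LEAD GO 13:49Z):
`MinimisingMapCompactness_holds` by Hardt–Kinderlehrer–Lin.  Helper `--supports stmt-QuantumFields-23533`; THEOREMS ONLY
(0 `def`, 0 `sorry`; ONE decl-local `maxHeartbeats 400000` with its `-- hb:` reason line, README №24 (a)).  Imports: (C-a3) ✓`…SobolevCubeExtraction` (w2), (C-d) D1
✓`…CompetitorTransfer` (px16 g9), (C-d0) ✓`…ShellPigeonhole` (px14 g6), (C-e) letters ✓`…MinimisingMapCompactnessLetters` (w2).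

WHAT THIS FILE DOES (Simon 1996 §2.9 Lemma 1, «no energy concentration»; HKL 1986 §2 for the sphere target).  Let `u_j : Q → S³`
be ball-minimising unit `W^{1,2}` maps with energies `≤ Λ`, converging in `L²(Q)` to a unit map `U` with weak gradient `G`,
integrable density, and the lower-semicontinuity row of (C-a3).  ASSUME the HKL shell-competitor socket (C-bc) with constant
`K`: for any two class members `u, V` and concentric balls `0 < ρ₁ < ρ₂`, `closedBall y ρ₂ ⊆ Q`, a class member `W` with
`W = V` on `ball y ρ₁`, `W = u` off `ball y ρ₂`, and shell energy `≤ K·(E(V,shell) + E(u,shell) + (ρ₂−ρ₁)⁻²∫_shell ‖V−u‖²)`.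
THEN for every ball with `closedBall y ρ ⊆ Q`, `ρ > 0`: `∫_{ball y ρ} Σ_i‖Gs_j e_i‖² → ∫_{ball y ρ} Σ_i‖G e_i‖²`
(★★★ `tendsto_energy_ball`).  Proof: `liminf ≥` is the lsc row; for `limsup ≤`, fix `ε`, a radius `t ∈ (ρ, ρ+δ)` with
`E(U,B_t) ≤ E(U,B_ρ) + ε/3` (shrinking balls), `N` with `K(E(U,Q)+Λ)/N ≤ ε/3`; for EACH `j` a shell of width `(t−ρ)/N` in
`(ρ,t)` carrying `≤ (E(U,Q)+Λ)/N` of `E(U)+E(u_j)` (pigeonhole, px14), the socket's competitor (inner map `U`), and D1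
(px16) against `u_j`'s minimality on a ball `B_{t′}`, `t < t′ < ρ+δ`:
`E(u_j,B_ρ) ≤ E(u_j,B_{ρ₂}) ≤ E(U,B_{ρ₁}) + E(W_j,shell) ≤ E(U,B_t) + K(E(U,Q)+Λ)/N + K·N²(t−ρ)⁻²‖u_j−U‖²_{L²(Q)}`.

HONEST SCOPE.  Conditional on the (C-bc) socket (a HYPOTHESIS `hHKL` here, discharged by w4 g15's (C-bc) file in the knit);
nothing of (C), (RS), S1″, S2♭″, `BlockLipschitzL`, `HistoryTailL` is proved here.  YM₃ on T³ is rung R3, not Clay.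

References: L. Simon, Theorems on Regularity and Singularity of Energy Minimizing Maps (1996) [Simon1996] (§2.9 Lemma 1);
R. Hardt, D. Kinderlehrer, F.-H. Lin, Existence and partial regularity of static liquid crystal configurations, Comm. Math.
Phys. 105 (1986) 547–570 [HardtKinderlehrerLin1986] (§2); S. Luckhaus, Indiana Univ. Math. J. 37 (1988) [Luckhaus1988].
-/

set_option autoImplicit false

noncomputable section

open MeasureTheory Set Function Filter Topology Metric TopologicalSpace
open scoped ENNReal BigOperators

namespace Summit.QuantumFields.YangMills.Theorems.PoincareLipschitzMinimisingMapCompactnessEnergy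

open Literature.Analysis.FunctionSpaces (HasWeakFDerivOn)
open Summit.QuantumFields.YangMills.Theorems.PoincareLipschitzCompetitorTransfer (competitor_transfer_of_ballMinimiser)
open Summit.QuantumFields.YangMills.Theorems.PoincareLipschitzShellPigeonhole (exists_shell_mul_setIntegral_le)
open Summit.QuantumFields.YangMills.Theorems.PoincareLipschitzMinimisingMapCompactnessLetters

/-! ## §1 Letters -/

/-- A closed ball inside the open cube has a concentric closed margin inside the cube. [folklore] -/
theorem exists_margin {Q : Set (EuclideanSpace ℝ (Fin 3))} (hQ : IsOpen Q) {y : EuclideanSpace ℝ (Fin 3)} {ρ : ℝ}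
    (hρ : 0 ≤ ρ) (hρQ : closedBall y ρ ⊆ Q) : ∃ δ : ℝ, 0 < δ ∧ closedBall y (ρ + δ) ⊆ Q := by
  obtain ⟨δ, hδ, h⟩ := (isCompact_closedBall y ρ).exists_cthickening_subset_open hQ hρQ
  refine ⟨δ, hδ, ?_⟩
  rw [cthickening_closedBall hδ.le hρ y, add_comm] at h
  exact h

/-- The Dirichlet density is pointwise nonnegative. [folklore] -/
theorem dens_nonneg (T : EuclideanSpace ℝ (Fin 3) →L[ℝ] EuclideanSpace ℝ (Fin 4)) :
    0 ≤ ∑ i : Fin 3, ‖T (EuclideanSpace.single i (1:ℝ))‖ ^ 2 :=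
  Finset.sum_nonneg fun _ _ => sq_nonneg _

/-- Monotonicity of the energy in the domain, for an integrable density. [folklore] -/
theorem energy_mono {G : EuclideanSpace ℝ (Fin 3) → (EuclideanSpace ℝ (Fin 3) →L[ℝ] EuclideanSpace ℝ (Fin 4))}
    {S T : Set (EuclideanSpace ℝ (Fin 3))} (hST : S ⊆ T)
    (hG : IntegrableOn (fun x => ∑ i : Fin 3, ‖G x (EuclideanSpace.single i (1:ℝ))‖ ^ 2) T volume) :
    ∫ x in S, ∑ i : Fin 3, ‖G x (EuclideanSpace.single i (1:ℝ))‖ ^ 2 ≤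
      ∫ x in T, ∑ i : Fin 3, ‖G x (EuclideanSpace.single i (1:ℝ))‖ ^ 2 :=
  setIntegral_mono_set hG (Eventually.of_forall fun x => dens_nonneg (G x)) hST.eventuallyLE

/-- The pigeonhole shell is the difference of two concentric open balls. [folklore] -/
theorem shell_eq_sdiff (y : EuclideanSpace ℝ (Fin 3)) (a b : ℝ) :
    {x : EuclideanSpace ℝ (Fin 3) | a ≤ dist x y ∧ dist x y < b} = ball y b \ ball y a := by
  ext x
  simp only [mem_setOf_eq, Set.mem_sdiff, mem_ball, not_lt]
  exact and_comm

/-! ## §2 Energy convergence on balls -/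

-- hb: README HEARTBEAT BUDGET ∕ №24 (a): measured FAIL at 100k ∕ PASS at the 200k default (one long bookkeeping proof,
-- cumulative budget; no single step is expensive); explicit headroom, statement and proof untouched — w2 g13 2026-08-29 15:05Z
set_option maxHeartbeats 400000 in
/-- ★★★ **(C-e1) ENERGY CONVERGENCE ON EVERY BALL** for a ball-minimising sequence of unit `W^{1,2}` maps `u_j : Q → S³`
converging in `L²(Q)` to `U` (weak gradient `G`, lower-semicontinuity row), CONDITIONAL on the HKL shell-competitor socket
`hHKL` with constant `K`: for `0 < ρ`, `closedBall y ρ ⊆ Q`, `∫_{ball y ρ} Σ_i‖Gs_j e_i‖² → ∫_{ball y ρ} Σ_i‖G e_i‖²`.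
[cite: Simon1996, §2.9 Lemma 1 (proof: no concentration via comparison maps)] -/
theorem tendsto_energy_ball (hQ : IsOpen {x : EuclideanSpace ℝ (Fin 3) | ∀ i : Fin 3, |x i| < 1}) {K : ℝ} (hK : 0 ≤ K)
    (hHKL : ∀ (u V : EuclideanSpace ℝ (Fin 3) → EuclideanSpace ℝ (Fin 4))
      (Gu GV : EuclideanSpace ℝ (Fin 3) → (EuclideanSpace ℝ (Fin 3) →L[ℝ] EuclideanSpace ℝ (Fin 4))),
      HasWeakFDerivOn ⟨{x : EuclideanSpace ℝ (Fin 3) | ∀ i : Fin 3, |x i| < 1}, hQ⟩ volume u Gu →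
      HasWeakFDerivOn ⟨{x : EuclideanSpace ℝ (Fin 3) | ∀ i : Fin 3, |x i| < 1}, hQ⟩ volume V GV →
      (∀ x : EuclideanSpace ℝ (Fin 3), (∀ i : Fin 3, |x i| < 1) → ‖u x‖ = 1) →
      (∀ x : EuclideanSpace ℝ (Fin 3), (∀ i : Fin 3, |x i| < 1) → ‖V x‖ = 1) →
      IntegrableOn (fun x => ∑ i : Fin 3, ‖Gu x (EuclideanSpace.single i (1:ℝ))‖ ^ 2)
        {x : EuclideanSpace ℝ (Fin 3) | ∀ i : Fin 3, |x i| < 1} volume →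
      IntegrableOn (fun x => ∑ i : Fin 3, ‖GV x (EuclideanSpace.single i (1:ℝ))‖ ^ 2)
        {x : EuclideanSpace ℝ (Fin 3) | ∀ i : Fin 3, |x i| < 1} volume →
      ∀ (y : EuclideanSpace ℝ (Fin 3)) (ρ₁ ρ₂ : ℝ), 0 < ρ₁ → ρ₁ < ρ₂ →
      closedBall y ρ₂ ⊆ {x : EuclideanSpace ℝ (Fin 3) | ∀ i : Fin 3, |x i| < 1} →
      ∃ (W : EuclideanSpace ℝ (Fin 3) → EuclideanSpace ℝ (Fin 4))
        (GW : EuclideanSpace ℝ (Fin 3) → (EuclideanSpace ℝ (Fin 3) →L[ℝ] EuclideanSpace ℝ (Fin 4))),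
        HasWeakFDerivOn ⟨{x : EuclideanSpace ℝ (Fin 3) | ∀ i : Fin 3, |x i| < 1}, hQ⟩ volume W GW ∧
        (∀ x : EuclideanSpace ℝ (Fin 3), (∀ i : Fin 3, |x i| < 1) → ‖W x‖ = 1) ∧
        IntegrableOn (fun x => ∑ i : Fin 3, ‖GW x (EuclideanSpace.single i (1:ℝ))‖ ^ 2)
          {x : EuclideanSpace ℝ (Fin 3) | ∀ i : Fin 3, |x i| < 1} volume ∧
        (∀ x ∈ ball y ρ₁, W x = V x) ∧ (∀ x, x ∉ ball y ρ₂ → W x = u x) ∧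
        ∫ x in ball y ρ₂ \ ball y ρ₁, ∑ i : Fin 3, ‖GW x (EuclideanSpace.single i (1:ℝ))‖ ^ 2 ≤
          K * ((∫ x in ball y ρ₂ \ ball y ρ₁, ∑ i : Fin 3, ‖GV x (EuclideanSpace.single i (1:ℝ))‖ ^ 2) +
            (∫ x in ball y ρ₂ \ ball y ρ₁, ∑ i : Fin 3, ‖Gu x (EuclideanSpace.single i (1:ℝ))‖ ^ 2) +
            (ρ₂ - ρ₁)⁻¹ ^ 2 * ∫ x in ball y ρ₂ \ ball y ρ₁, ‖V x - u x‖ ^ 2))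
    {u : ℕ → EuclideanSpace ℝ (Fin 3) → EuclideanSpace ℝ (Fin 4)}
    {Gs : ℕ → EuclideanSpace ℝ (Fin 3) → (EuclideanSpace ℝ (Fin 3) →L[ℝ] EuclideanSpace ℝ (Fin 4))} {Λ : ℝ}
    (hu : ∀ j, HasWeakFDerivOn ⟨{x : EuclideanSpace ℝ (Fin 3) | ∀ i : Fin 3, |x i| < 1}, hQ⟩ volume (u j) (Gs j))
    (hu1 : ∀ j (x : EuclideanSpace ℝ (Fin 3)), (∀ i : Fin 3, |x i| < 1) → ‖u j x‖ = 1)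
    (hGi : ∀ j, IntegrableOn (fun x => ∑ i : Fin 3, ‖Gs j x (EuclideanSpace.single i (1:ℝ))‖ ^ 2)
      {x : EuclideanSpace ℝ (Fin 3) | ∀ i : Fin 3, |x i| < 1} volume)
    (hmin : ∀ (j : ℕ) (y : EuclideanSpace ℝ (Fin 3)) (ρ : ℝ), 0 < ρ →
      closedBall y ρ ⊆ {x : EuclideanSpace ℝ (Fin 3) | ∀ i : Fin 3, |x i| < 1} →
      ∀ (W : EuclideanSpace ℝ (Fin 3) → EuclideanSpace ℝ (Fin 4))
        (GW : EuclideanSpace ℝ (Fin 3) → (EuclideanSpace ℝ (Fin 3) →L[ℝ] EuclideanSpace ℝ (Fin 4))),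
      HasWeakFDerivOn ⟨{x : EuclideanSpace ℝ (Fin 3) | ∀ i : Fin 3, |x i| < 1}, hQ⟩ volume W GW →
      (∀ x : EuclideanSpace ℝ (Fin 3), (∀ i : Fin 3, |x i| < 1) → ‖W x‖ = 1) →
      IntegrableOn (fun x => ∑ i : Fin 3, ‖GW x (EuclideanSpace.single i (1:ℝ))‖ ^ 2)
        {x : EuclideanSpace ℝ (Fin 3) | ∀ i : Fin 3, |x i| < 1} →
      (∃ ρ' : ℝ, ρ' < ρ ∧ ∀ x : EuclideanSpace ℝ (Fin 3), x ∉ ball y ρ' → W x = u j x) →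
      ∫ x in ball y ρ, ∑ i : Fin 3, ‖Gs j x (EuclideanSpace.single i (1:ℝ))‖ ^ 2 ≤
        ∫ x in ball y ρ, ∑ i : Fin 3, ‖GW x (EuclideanSpace.single i (1:ℝ))‖ ^ 2)
    (hΛ : ∀ j, ∫ x in {x : EuclideanSpace ℝ (Fin 3) | ∀ i : Fin 3, |x i| < 1},
      ∑ i : Fin 3, ‖Gs j x (EuclideanSpace.single i (1:ℝ))‖ ^ 2 ≤ Λ)
    {U : EuclideanSpace ℝ (Fin 3) → EuclideanSpace ℝ (Fin 4)}
    {G : EuclideanSpace ℝ (Fin 3) → (EuclideanSpace ℝ (Fin 3) →L[ℝ] EuclideanSpace ℝ (Fin 4))}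
    (hUG : HasWeakFDerivOn ⟨{x : EuclideanSpace ℝ (Fin 3) | ∀ i : Fin 3, |x i| < 1}, hQ⟩ volume U G)
    (hU1 : ∀ x, ‖U x‖ = 1)
    (hGdens : IntegrableOn (fun x => ∑ i : Fin 3, ‖G x (EuclideanSpace.single i (1:ℝ))‖ ^ 2)
      {x : EuclideanSpace ℝ (Fin 3) | ∀ i : Fin 3, |x i| < 1} volume)
    (hL2 : Tendsto (fun j => ∫ x in {x : EuclideanSpace ℝ (Fin 3) | ∀ i : Fin 3, |x i| < 1}, ‖u j x - U x‖ ^ 2)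
      atTop (𝓝 0))
    (hlsc : ∀ S : Set (EuclideanSpace ℝ (Fin 3)), MeasurableSet S → S ⊆ {x : EuclideanSpace ℝ (Fin 3) | ∀ i : Fin 3, |x i| < 1} →
      ∀ M : ℝ, (∃ᶠ j in atTop, ∫ x in S, ∑ i : Fin 3, ‖Gs j x (EuclideanSpace.single i (1:ℝ))‖ ^ 2 ≤ M) →
        ∫ x in S, ∑ i : Fin 3, ‖G x (EuclideanSpace.single i (1:ℝ))‖ ^ 2 ≤ M)
    {y : EuclideanSpace ℝ (Fin 3)} {ρ : ℝ} (hρ : 0 < ρ)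
    (hρQ : closedBall y ρ ⊆ {x : EuclideanSpace ℝ (Fin 3) | ∀ i : Fin 3, |x i| < 1}) :
    Tendsto (fun j => ∫ x in ball y ρ, ∑ i : Fin 3, ‖Gs j x (EuclideanSpace.single i (1:ℝ))‖ ^ 2) atTop
      (𝓝 (∫ x in ball y ρ, ∑ i : Fin 3, ‖G x (EuclideanSpace.single i (1:ℝ))‖ ^ 2)) := by
  set Q : Set (EuclideanSpace ℝ (Fin 3)) := {x | ∀ i : Fin 3, |x i| < 1} with hQdef
  have hQm : MeasurableSet Q := hQ.measurableSet
  have hU1' : ∀ x : EuclideanSpace ℝ (Fin 3), (∀ i : Fin 3, |x i| < 1) → ‖U x‖ = 1 := fun x _ => hU1 x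
  -- margin and the two totals
  obtain ⟨δ, hδ, hδQ⟩ := exists_margin hQ hρ.le hρQ
  set EU : ℝ := ∫ x in Q, ∑ i : Fin 3, ‖G x (EuclideanSpace.single i (1:ℝ))‖ ^ 2 with hEU
  have hEU0 : 0 ≤ EU := setIntegral_nonneg hQm fun x _ => dens_nonneg (G x)
  have hΛ0 : 0 ≤ Λ := (setIntegral_nonneg hQm fun x _ => dens_nonneg (Gs 0 x)).trans (hΛ 0)
  refine tendsto_of_lsc_of_eventually_le
    (fun M hM => hlsc _ measurableSet_ball (ball_subset_closedBall.trans hρQ) M hM) fun ε hε => ?_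
  -- the radius `t`
  have hGballδ : IntegrableOn (fun x => ∑ i : Fin 3, ‖G x (EuclideanSpace.single i (1:ℝ))‖ ^ 2) (ball y (ρ + δ)) volume :=
    hGdens.mono_set (ball_subset_closedBall.trans hδQ)
  obtain ⟨t, hρt, htδ, hEt⟩ := exists_radius_setIntegral_ball_le_add hδ (by positivity : (0:ℝ) < ε / 3) hGballδ
  -- the number of shells `N`
  obtain ⟨N, hNpos, hN⟩ : ∃ N : ℕ, 0 < N ∧ K * (EU + Λ) / N ≤ ε / 3 := by
    obtain ⟨N, hN⟩ := exists_nat_gt (K * (EU + Λ) / (ε / 3))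
    have hNpos : 0 < N := by
      have : (0 : ℝ) < N := lt_of_le_of_lt (by positivity) hN
      exact_mod_cast this
    refine ⟨N, hNpos, ?_⟩
    have hN' : (0 : ℝ) < N := by exact_mod_cast hNpos
    rw [div_le_iff₀ hN']
    have := (div_lt_iff₀ (by positivity : (0:ℝ) < ε / 3)).1 hN
    linarith
  have hNr : (0 : ℝ) < N := by exact_mod_cast hNpos
  set h : ℝ := (t - ρ) / N with hh
  have hh0 : 0 < h := div_pos (by linarith) hNr
  have hNh : (N : ℝ) * h = t - ρ := by rw [hh]; field_simp
  set t' : ℝ := (t + (ρ + δ)) / 2 with ht'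
  have htt' : t < t' := by rw [ht']; linarith
  have ht'δ : t' < ρ + δ := by rw [ht']; linarith
  have ht'0 : 0 < t' := by linarith
  have ht'Q : closedBall y t' ⊆ Q := (closedBall_subset_closedBall ht'δ.le).trans hδQ
  have htQ : ball y t ⊆ Q := (ball_subset_closedBall.trans (closedBall_subset_closedBall htδ.le)).trans hδQ
  -- the per-`j` bound
  have hab : ∀ j, ∫ x in ball y ρ, ∑ i : Fin 3, ‖Gs j x (EuclideanSpace.single i (1:ℝ))‖ ^ 2 ≤
      (∫ x in ball y t, ∑ i : Fin 3, ‖G x (EuclideanSpace.single i (1:ℝ))‖ ^ 2) + K * (EU + Λ) / N +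
        K * (h⁻¹ ^ 2 * ∫ x in Q, ‖u j x - U x‖ ^ 2) := by
    intro j
    -- the region of the shells and the pigeonhole
    have hreg : {x : EuclideanSpace ℝ (Fin 3) | ρ ≤ dist x y ∧ dist x y < ρ + N * h} ⊆ Q := by
      rw [shell_eq_sdiff]; rw [hNh, add_sub_cancel]; exact sdiff_subset.trans htQ
    have hfint : IntegrableOn (fun x => (∑ i : Fin 3, ‖G x (EuclideanSpace.single i (1:ℝ))‖ ^ 2) +
        ∑ i : Fin 3, ‖Gs j x (EuclideanSpace.single i (1:ℝ))‖ ^ 2)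
        {x : EuclideanSpace ℝ (Fin 3) | ρ ≤ dist x y ∧ dist x y < ρ + N * h} volume :=
      (hGdens.mono_set hreg).add ((hGi j).mono_set hreg)
    obtain ⟨i, hiN, hi⟩ := exists_shell_mul_setIntegral_le volume y ρ hh0 hNpos hfint
    set ρ₁ : ℝ := ρ + i * h with hρ₁
    set ρ₂ : ℝ := ρ + (i + 1) * h with hρ₂
    have hi0 : (0 : ℝ) ≤ i := by exact_mod_cast Nat.zero_le i
    have hiN' : (i : ℝ) + 1 ≤ N := by exact_mod_cast hiN
    have hρρ₁ : ρ ≤ ρ₁ := by rw [hρ₁]; nlinarith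
    have h12 : ρ₁ < ρ₂ := by rw [hρ₁, hρ₂]; nlinarith
    have h21 : ρ₂ - ρ₁ = h := by rw [hρ₁, hρ₂]; ring
    have hρ₂t : ρ₂ ≤ t := by
      rw [hρ₂]
      have : ((i : ℝ) + 1) * h ≤ N * h := mul_le_mul_of_nonneg_right hiN' hh0.le
      linarith
    have hρ₁0 : 0 < ρ₁ := lt_of_lt_of_le hρ hρρ₁
    have hρ₂Q : closedBall y ρ₂ ⊆ Q := (closedBall_subset_closedBall (hρ₂t.trans htt'.le)).trans ht'Q
    have hshell : {x : EuclideanSpace ℝ (Fin 3) | ρ + i * h ≤ dist x y ∧ dist x y < ρ + (i + 1) * h} =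
        ball y ρ₂ \ ball y ρ₁ := shell_eq_sdiff y _ _
    have hshellQ : ball y ρ₂ \ ball y ρ₁ ⊆ Q := sdiff_subset.trans (ball_subset_closedBall.trans hρ₂Q)
    -- the shell carries little energy
    have hsmall : (∫ x in ball y ρ₂ \ ball y ρ₁, ∑ i : Fin 3, ‖G x (EuclideanSpace.single i (1:ℝ))‖ ^ 2) +
        ∫ x in ball y ρ₂ \ ball y ρ₁, ∑ i : Fin 3, ‖Gs j x (EuclideanSpace.single i (1:ℝ))‖ ^ 2 ≤ (EU + Λ) / N := by
      rw [hshell] at hi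
      rw [← integral_add (hGdens.mono_set hshellQ) ((hGi j).mono_set hshellQ)]
      rw [le_div_iff₀ hNr, mul_comm]
      refine hi.trans ?_
      rw [integral_add (hGdens.mono_set hreg) ((hGi j).mono_set hreg)]
      exact add_le_add (energy_mono hreg hGdens) ((energy_mono hreg (hGi j)).trans (hΛ j))
    -- the competitor and the transfer
    obtain ⟨W, GW, hWd, hW1, hWi, hWin, hWout, hWsh⟩ :=
      hHKL (u j) U (Gs j) G (hu j) hUG (hu1 j) hU1' (hGi j) hGdens y ρ₁ ρ₂ hρ₁0 h12 hρ₂Q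
    have hD1 := competitor_transfer_of_ballMinimiser hQ (hu j) (hGi j) ht'Q (hmin j y t' ht'0 ht'Q) hUG hWd hW1 hWi
      h12.le (lt_of_le_of_lt hρ₂t htt') hWin hWout
    -- the `L²` term on the shell
    have hL2sh : ∫ x in ball y ρ₂ \ ball y ρ₁, ‖U x - u j x‖ ^ 2 ≤ ∫ x in Q, ‖u j x - U x‖ ^ 2 := by
      have hint : IntegrableOn (fun x => ‖u j x - U x‖ ^ 2) Q volume := by
        haveI : IsFiniteMeasure (volume.restrict Q) := isFiniteMeasure_restrict.2
          (Summit.QuantumFields.YangMills.Theorems.PoincareLipschitzDyadicMeansWeakLimit.volume_openCube_lt_top).ne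
        refine Summit.QuantumFields.YangMills.Theorems.PoincareLipschitzBlowDownWeakGradientLetters.integrable_of_norm_le
          (((hu j).locallyIntegrableOn.aestronglyMeasurable.sub
            hUG.locallyIntegrableOn.aestronglyMeasurable).norm.pow 2) 4 ?_
        filter_upwards [ae_restrict_mem hQm] with x hx
        rw [Real.norm_eq_abs, abs_of_nonneg (sq_nonneg _)]
        have h1 : ‖u j x - U x‖ ≤ 2 := by
          calc ‖u j x - U x‖ ≤ ‖u j x‖ + ‖U x‖ := norm_sub_le _ _
            _ = 2 := by rw [hu1 j x hx, hU1 x]; norm_num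
        nlinarith [norm_nonneg (u j x - U x)]
      simp_rw [norm_sub_rev (U _) (u j _)]
      exact setIntegral_mono_set hint (Eventually.of_forall fun x => sq_nonneg _) hshellQ.eventuallyLE
    calc ∫ x in ball y ρ, ∑ i : Fin 3, ‖Gs j x (EuclideanSpace.single i (1:ℝ))‖ ^ 2
        ≤ ∫ x in ball y ρ₂, ∑ i : Fin 3, ‖Gs j x (EuclideanSpace.single i (1:ℝ))‖ ^ 2 :=
          energy_mono (ball_subset_ball (hρρ₁.trans h12.le)) ((hGi j).mono_set (ball_subset_closedBall.trans hρ₂Q))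
      _ ≤ (∫ x in ball y ρ₁, ∑ i : Fin 3, ‖G x (EuclideanSpace.single i (1:ℝ))‖ ^ 2) +
            ∫ x in ball y ρ₂ \ ball y ρ₁, ∑ i : Fin 3, ‖GW x (EuclideanSpace.single i (1:ℝ))‖ ^ 2 := hD1
      _ ≤ (∫ x in ball y t, ∑ i : Fin 3, ‖G x (EuclideanSpace.single i (1:ℝ))‖ ^ 2) +
            K * ((∫ x in ball y ρ₂ \ ball y ρ₁, ∑ i : Fin 3, ‖G x (EuclideanSpace.single i (1:ℝ))‖ ^ 2) +
              (∫ x in ball y ρ₂ \ ball y ρ₁, ∑ i : Fin 3, ‖Gs j x (EuclideanSpace.single i (1:ℝ))‖ ^ 2) +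
              (ρ₂ - ρ₁)⁻¹ ^ 2 * ∫ x in ball y ρ₂ \ ball y ρ₁, ‖U x - u j x‖ ^ 2) :=
          add_le_add (energy_mono (ball_subset_ball (h12.le.trans hρ₂t)) (hGdens.mono_set htQ)) hWsh
      _ ≤ (∫ x in ball y t, ∑ i : Fin 3, ‖G x (EuclideanSpace.single i (1:ℝ))‖ ^ 2) + K * (EU + Λ) / N +
            K * (h⁻¹ ^ 2 * ∫ x in Q, ‖u j x - U x‖ ^ 2) := by
          rw [h21]
          have h3 : (h⁻¹ ^ 2 * ∫ x in ball y ρ₂ \ ball y ρ₁, ‖U x - u j x‖ ^ 2) ≤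
              h⁻¹ ^ 2 * ∫ x in Q, ‖u j x - U x‖ ^ 2 := mul_le_mul_of_nonneg_left hL2sh (by positivity)
          have e1 := mul_le_mul_of_nonneg_left hsmall hK
          have e2 := mul_le_mul_of_nonneg_left h3 hK
          have e3 : K * ((∫ x in ball y ρ₂ \ ball y ρ₁, ∑ i : Fin 3, ‖G x (EuclideanSpace.single i (1:ℝ))‖ ^ 2) +
              (∫ x in ball y ρ₂ \ ball y ρ₁, ∑ i : Fin 3, ‖Gs j x (EuclideanSpace.single i (1:ℝ))‖ ^ 2) +
              h⁻¹ ^ 2 * ∫ x in ball y ρ₂ \ ball y ρ₁, ‖U x - u j x‖ ^ 2) =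
              K * ((∫ x in ball y ρ₂ \ ball y ρ₁, ∑ i : Fin 3, ‖G x (EuclideanSpace.single i (1:ℝ))‖ ^ 2) +
                ∫ x in ball y ρ₂ \ ball y ρ₁, ∑ i : Fin 3, ‖Gs j x (EuclideanSpace.single i (1:ℝ))‖ ^ 2) +
              K * (h⁻¹ ^ 2 * ∫ x in ball y ρ₂ \ ball y ρ₁, ‖U x - u j x‖ ^ 2) := by ring
          have e4 : K * ((EU + Λ) / N) = K * (EU + Λ) / N := by ring
          linarith
  -- conclude
  refine eventually_le_add_of_three hε hab hEt hN ?_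
  have := (hL2.const_mul (h⁻¹ ^ 2)).const_mul K
  simpa using this

end Summit.QuantumFields.YangMills.Theorems.PoincareLipschitzMinimisingMapCompactnessEnergy

end
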